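import Literature.MathematicalPhysics.QuantumFieldTheory.Balaban1983to89.B9Eq349BlockMultipliers
import Literature.MathematicalPhysics.QuantumFieldTheory.Balaban1983to89.B9Eq349BlockDistanceWeight
import Literature.MathematicalPhysics.QuantumFieldTheory.Balaban1983to89.B5Eq172FlatCoercivity

/-!
# `Balaban1983to89.B9Eq349BlockDecayFromKernel` — T. Bałaban, *Propagators for lattice gauge theories in a background field*, Commun. Math. Phys.
# **99** (1985) 389–434 [Balaban1985BackgroundPropagators] (3.49) p. 399 («|(DPD*)(x,x′)| ≤ O(1)e^{−δ₀d(y,y′)} for x ∈ Δ(y), x′ ∈ Δ(y′)» — an ENTRYWISE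
# kernel statement) against (3.101) p. 414 (its consumption as an OPERATOR between blocks), with [Balaban1984PropagatorsI] (1.126) p. 38 and
# [Balaban1983RegularityDecay] Lemma 2.4 (2.35) p. 582 (the flat kernels): **ROW L9's BLOCK-DECAY LETTER FROM A KERNEL — if
# `T : L²(fine sites) → L²(bonds)` has matrix entries `‖T(b, x)‖ ≤ K·e^{−κ·d_m(blk b, blk x)}` in the COARSE torus metric, then for every pair of `L`-blocks
# `‖1_{Δ(y₁)} ∘ T ∘ 1_{Δ(y₀)}‖ ≤ √d·L^d·K·e^{−κ·d_m(y₀,y₁)}` (the `hτ` letter of row L9's `k_W` assembly VERBATIM); every map between the carriers HAS a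
# kernel, and kernels compose by coarse convolution** — route R2′ STEP B8′ of the pub-balaban NE9 chain, the ENTRY of road B8″ (the flat-strip supplier of
# `hτ`: Paley–Wiener kernels of [B4]∕[B5′] at `U ≡ 1` in, `hτ` out)

statement-level skeleton of published theorems with citation tags; proofs where landed; nothing here is a claim about the Yang–Mills mass gap

CITATION HEADER (lean-in-tree rule).  Audit cell `pub-balaban`, sub-cell `t4`, BINDER row NE9; filed by NE9 formalisation-swarm LEAF PROVER 06
(`b2b-balaban-t4-ne9-formalise-leaf-06`, gen 68; the S-P5(b) porter: parts 0–5′ `B9Eq311PointwiseMultipliers` … `B9Eq349ConjugatedDPCircleWindows`) as the FIRST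
BRICK of road B8″ of `t4/ROUTES-NE9.md` v13.37 ADDENDUM (ii) (t4-ne9-idea-1 gen 100, «S1∕S2 … ⇒ `hτ` at U ≡ 1», offered by name to ne9-leaf-01 ∕ ne9-leaf-06,
journal 2026-08-23 l.51680): the JUNCTION between entrywise kernel decay — the currency in which the cell's flat engines deliver ([B4] (2.48) on the torus:
`B4Torus248Decay.kernel248_torusKernel_decay_torusMetric`; [B5′] (1.45): `B5Torus145Decay.inverse145_torusKernelM_decay_torusMetric`; the generic
`B4TorusKernel.MultiPeriod.torusKernel_descend_decay_torusMetric`) — and the block-operator letter `hτ` consumed by ne9-leaf-01's `B9Eq349KWAssembly` §3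
`norm_sum_adad_le_lattice` (p360108 ✓; (K3) `B9Eq349ConjugatedDPBlockDecay` p359248 ✓ is the OTHER supplier of the same letter, from this lineage's circle
letter at rate `r = O(√κ₁)`).  Sources READ in the held text [Balaban1985BackgroundPropagators]
(`paper:balaban1985-cmp99-background-propagators`, journal page = PDF page + 388): p. 399 (3.49), p. 414 (3.101), p. 415 («random walk expansion»);
[Balaban1984PropagatorsI] p. 38 (1.126) and [Balaban1983RegularityDecay] p. 582 (2.35) through the cell's audited headers (`B5Strip145`, `B4Torus248Decay`).

THE PRINT (verbatim).  [B9] p. 399 (3.49): *«|(G̃(U)f)(x)|, |(∇^η_U G̃(U)f)(x)|, … ≤ O(1)e^{−δ₀d(y,y′)}‖f‖ for x ∈ Δ(y), supp f ⊂ Δ(y′)»* (the block-to-block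
form); p. 414 (3.101): *«The operator P₁(∂h) satisfies the inequalities (3.49) with the additional small factor O(M⁻¹) … together with the exponential decay
of DPD*.»*; [B5′] p. 38 (1.126): *«|(∂P∂*)_{μ,ν}(x, x′)| ≤ O(1)e^{−δ′₀|x−x′|}»* (the entrywise form); [B4] p. 582 (2.35): *«|(G_j(□)Q_j^*)(x,y)|,
|(∂^{L^{−j}}_μ G_j(□)Q_j^*)(x,y)| ≤ c₀e^{−δ₀|x−y|}»*.  Print passes between the entrywise and the block-operator forms without comment (finite blocks);
this file is that passage on the tree's carriers, nothing of print's estimates being asserted.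

WHAT IS PROVED (sorry-free; proof lane — no `def`; [folklore] finite-dimensional bookkeeping; `RCLike 𝕜` carriers `B9Eq311L2Pairing.WL2`).
* §1 KERNELS (abstract; (K1)'s letters `hP`): **`kernel_apply_single`** (a kernel is determined: `t b x v = (T δ_x v)(b)`), **`exists_kernel`** (every CLM
  between finite weighted `ℓ²` carriers (finite-dimensional source fibre) HAS a kernel `t : X_E → X_S → (V →L V′)`, `(Tf)(b) = Σ_x t b x (f x)`),
  **`kernel_comp`** (kernels compose: `(T₂ ∘ T₁)(b, x) = Σ_z t₂ b z ∘ t₁ z x`).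
* §2 BLOCKS FROM ENTRIES (abstract): **`equiv_block_comp_comp_block`** (the sandwiched map pointwise), **`norm_block_comp_comp_block_apply_le`** ∕
  **`opNorm_block_comp_comp_block_le`**: entries `‖t b x‖ ≤ K` on the cell pair `(y₁, y₀)`, cell sizes `≤ N_E`, `≤ N_S`, weight ratio `w_E(b) ≤ ρ·w_S(x)` ⟹
  `‖P^E_{y₁} ∘ T ∘ P^S_{y₀}‖ ≤ √(ρ·N_E·N_S)·K` (Cauchy–Schwarz on the cell; a weighted Hilbert–Schmidt bound).
* §3 THE LATTICE LETTER (ne9-leaf-01's binders VERBATIM: fine torus `T_{(L·m)}`, `SiteL2K`∕`BondL2K` with weight `c₀`, blocks `blockCoord`, bonds based at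
  `bpos`, `tdist m`): **`block_decay_of_kernel`** — `(Tf)(b) = Σ_x t b x (f x)`, `‖t b x‖ ≤ K·e^{−κ·d_m(blk(b₋), blk x)}` ⟹ for ALL block families
  `P^S`, `P^B` (letters `hPS`, `hPB`) and all `y₀, y₁`: `‖P^B_{y₁} ∘L T ∘L P^S_{y₀}‖ ≤ (√d·L^d·K)·e^{−(κ·d_m(y₀,y₁))}`; **`block_decay_of_scalar_kernel`**
  (`(Tf)(b) = Σ_x k(b,x)•f(x)`, the flat shape `scalar ⊗ 1_W`).  The composed shape (`k = A∗c∗B` over the coarse torus, the form in which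
  `T(1) = (D_1G′Q̃′†)·(Q̃′G′²Q̃′†)⁻¹·(Q̃′G′)` arrives) is the sequel `B9Eq349KernelConvolutionDecay`.
HONEST SCOPE.  Bookkeeping only: no operator of the paper is given a kernel here (that is road B8″ S1: the flat `T(1) = D_1(1 − R(1)) = (D_1G′Q̃′†)·
(Q̃′G′²Q̃′†)⁻¹·(Q̃′G′)` read through the J-M-α dictionary `B9Eq365QGGQFlatCarrierDictionary`∕`…SymbolTransfer` on b04∕b05's torus kernels — NOT here);
no decay rate is produced (the rate `κ` is a hypothesis; print's `δ₀` is not valued); the constant `√d·L^d` is crude (Hilbert–Schmidt on a block).  ONE junction of ONE sub-step (row L9's `hτ`) of route R2′ STEP B8′, NOT NE9 (cell pub-balaban: NE9 NOT PRINTED ∕ NOT PROVED;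
«NE9 ⇐ the named binders»; row WALLED ON A MODEL (O-NE9-1; #5 UNRULED); spine PROVED 0∕9; rung (B)+1 on a finite T⁴ — NOT infinite volume, NOT mass gap,
NOT Clay; HONEST DEPENDENCY: continuum YM on T⁴ ⇐ BetaPertH ∧ nine spine estimates (0/9 proved); BetaPertH ⇐ (D1) ∧ (D4) ∧ CAP+tail; G-an2-4 gates asym,
D1 and NE2/3/4).  NEW file importing (K1) `B9Eq349BlockMultipliers`, (K2) `B9Eq349BlockDistanceWeight` (⊇ `B4Sect5Torus`, the carriers) and
`B5Eq172FlatCoercivity` (`card_blockOf`); nothing modified.  Net new unproved facts: 0.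
-/

noncomputable section

set_option autoImplicit false

open scoped BigOperators

namespace Literature.MathematicalPhysics.QuantumFieldTheory.Balaban1983to89.B9Eq349BlockDecayFromKernel

open B4Sect5Torus (TSite tdist tdist_symm)
open B9SectCLatticeCarrier (Bond bpos)
open B9Eq311L2Pairing (WL2)
open B9Eq319QprimeTorus (fineP blockCoord mem_blockOf_iff)
open B11Eq103H1Complex (SiteL2K BondL2K)
open B5Eq172FlatCoercivity (card_blockOf)

/-! ## §1 Kernels of maps between weighted `ℓ²` carriers -/

section Kernel

variable {𝕜 : Type*} [RCLike 𝕜] {XS XE : Type*} [Fintype XS] [Fintype XE] [DecidableEq XS]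
  {wS : XS → ℝ} {wE : XE → ℝ} [Fact (∀ x, 0 < wS x)] [Fact (∀ b, 0 < wE b)]
  {V V' : Type*} [NormedAddCommGroup V] [InnerProductSpace 𝕜 V] [NormedAddCommGroup V'] [InnerProductSpace 𝕜 V']

/-- the identification commutes with finite sums, pointwise (private helper). [folklore] -/
private theorem equiv_sum {X : Type*} {w : X → ℝ} {U : Type*} [AddCommGroup U] [Module 𝕜 U] {ι : Type*} (s : Finset ι)
    (g : ι → WL2 𝕜 w U) (x : X) : WL2.equiv 𝕜 w U (∑ i ∈ s, g i) x = ∑ i ∈ s, WL2.equiv 𝕜 w U (g i) x := by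
  classical
  induction s using Finset.induction_on with
  | empty => simp
  | insert a s ha ih => rw [Finset.sum_insert ha, Finset.sum_insert ha, WL2.equiv_add, Pi.add_apply, ih]

/-- **A KERNEL IS DETERMINED BY THE MAP**: if `(Tf)(b) = Σ_x t b x (f x)` for all `f`, then `t b x v = (T(δ_x v))(b)`. [folklore]
[cite: Balaban1984PropagatorsI, (1.126) p.38 «(∂P∂*)_{μ,ν}(x, x′)»] -/
theorem kernel_apply_single {T : WL2 𝕜 wS V →L[𝕜] WL2 𝕜 wE V'} {t : XE → XS → V →L[𝕜] V'}
    (hT : ∀ (f : WL2 𝕜 wS V) (b : XE), WL2.equiv 𝕜 wE V' (T f) b = ∑ x, t b x (WL2.equiv 𝕜 wS V f x))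
    (b : XE) (x : XS) (v : V) :
    t b x v = WL2.equiv 𝕜 wE V' (T ((WL2.equiv 𝕜 wS V).symm (Pi.single x v))) b := by
  rw [hT]
  simp only [Equiv.apply_symm_apply]
  rw [Finset.sum_eq_single x, Pi.single_eq_same]
  · intro x' _ hx'; rw [Pi.single_eq_of_ne hx', map_zero]
  · intro h; exact absurd (Finset.mem_univ x) h

variable [FiniteDimensional 𝕜 V]

/-- **EVERY MAP HAS A KERNEL** (finite index sets, finite-dimensional source fibre): `∃ t, (Tf)(b) = Σ_x t b x (f x)` with `t b x : V →L V′`.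
No definition is minted (`LinearMap.toContinuousLinearMap` of `v ↦ (T(δ_x v))(b)`). [folklore] [cite: Balaban1984PropagatorsI, (1.126) p.38] -/
theorem exists_kernel (T : WL2 𝕜 wS V →L[𝕜] WL2 𝕜 wE V') :
    ∃ t : XE → XS → V →L[𝕜] V', ∀ (f : WL2 𝕜 wS V) (b : XE), WL2.equiv 𝕜 wE V' (T f) b = ∑ x, t b x (WL2.equiv 𝕜 wS V f x) := by
  refine ⟨fun b x => LinearMap.toContinuousLinearMap
    ((LinearMap.proj b : (XE → V') →ₗ[𝕜] V') ∘ₗ (WL2.linearEquiv 𝕜 𝕜 wE (V := V')).toLinearMap ∘ₗ (T : WL2 𝕜 wS V →ₗ[𝕜] WL2 𝕜 wE V') ∘ₗ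
      (WL2.linearEquiv 𝕜 𝕜 wS (V := V)).symm.toLinearMap ∘ₗ (LinearMap.single 𝕜 (fun _ : XS => V) x)), fun f b => ?_⟩
  have hf : f = ∑ x, (WL2.equiv 𝕜 wS V).symm (Pi.single x (WL2.equiv 𝕜 wS V f x)) := by
    apply (WL2.equiv 𝕜 wS V).injective
    funext x'
    rw [equiv_sum]
    simp only [Equiv.apply_symm_apply]
    rw [Finset.sum_eq_single x', Pi.single_eq_same]
    · intro x _ hx; exact Pi.single_eq_of_ne' hx _
    · intro h; exact absurd (Finset.mem_univ x') h
  conv_lhs => rw [hf]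
  rw [map_sum, equiv_sum]
  refine Finset.sum_congr rfl fun x _ => ?_
  simp only [LinearMap.coe_toContinuousLinearMap', LinearMap.coe_comp, Function.comp_apply, LinearEquiv.coe_coe,
    WL2.linearEquiv_symm_apply, WL2.linearEquiv_apply, LinearMap.coe_proj, Function.eval, ContinuousLinearMap.coe_coe,
    LinearMap.single_apply]

omit [DecidableEq XS] [FiniteDimensional 𝕜 V] in
/-- **KERNELS COMPOSE** (`X_M` a finite middle index, any weight): `(T₂ ∘ T₁)(b, x) = Σ_z t₂ b z ∘ t₁ z x`. [folklore]
[cite: Balaban1984PropagatorsI, p.38 «P = G′Q′*(Q′G′²Q′*)⁻¹Q′G′»] -/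
theorem kernel_comp {XM : Type*} [Fintype XM] {wM : XM → ℝ} [Fact (∀ z, 0 < wM z)] {U : Type*} [NormedAddCommGroup U] [InnerProductSpace 𝕜 U]
    {T₁ : WL2 𝕜 wS V →L[𝕜] WL2 𝕜 wM U} {t₁ : XM → XS → V →L[𝕜] U}
    (hT₁ : ∀ (f : WL2 𝕜 wS V) (z : XM), WL2.equiv 𝕜 wM U (T₁ f) z = ∑ x, t₁ z x (WL2.equiv 𝕜 wS V f x))
    {T₂ : WL2 𝕜 wM U →L[𝕜] WL2 𝕜 wE V'} {t₂ : XE → XM → U →L[𝕜] V'}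
    (hT₂ : ∀ (g : WL2 𝕜 wM U) (b : XE), WL2.equiv 𝕜 wE V' (T₂ g) b = ∑ z, t₂ b z (WL2.equiv 𝕜 wM U g z))
    (f : WL2 𝕜 wS V) (b : XE) :
    WL2.equiv 𝕜 wE V' ((T₂ ∘L T₁) f) b = ∑ x, (∑ z, t₂ b z ∘L t₁ z x) (WL2.equiv 𝕜 wS V f x) := by
  rw [ContinuousLinearMap.comp_apply, hT₂]
  simp only [hT₁, map_sum, _root_.sum_apply, ContinuousLinearMap.comp_apply]
  rw [Finset.sum_comm]

end Kernel

/-! ## §2 Blocks from entries: a weighted Hilbert–Schmidt bound on a cell pair -/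

section Blocks

variable {𝕜 : Type*} [RCLike 𝕜] {XS XE Y : Type*} [Fintype XS] [Fintype XE] [DecidableEq Y]
  {wS : XS → ℝ} {wE : XE → ℝ} [Fact (∀ x, 0 < wS x)] [Fact (∀ b, 0 < wE b)]
  {V V' : Type*} [NormedAddCommGroup V] [InnerProductSpace 𝕜 V] [NormedAddCommGroup V'] [InnerProductSpace 𝕜 V']
  {πS : XS → Y} {πE : XE → Y}
  {PS : Y → WL2 𝕜 wS V →L[𝕜] WL2 𝕜 wS V} {PE : Y → WL2 𝕜 wE V' →L[𝕜] WL2 𝕜 wE V'}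
  (hPS : ∀ (y : Y) (f : WL2 𝕜 wS V) (x : XS), WL2.equiv 𝕜 wS V (PS y f) x = if πS x = y then WL2.equiv 𝕜 wS V f x else 0)
  (hPE : ∀ (y : Y) (g : WL2 𝕜 wE V') (b : XE), WL2.equiv 𝕜 wE V' (PE y g) b = if πE b = y then WL2.equiv 𝕜 wE V' g b else 0)
  {T : WL2 𝕜 wS V →L[𝕜] WL2 𝕜 wE V'} {t : XE → XS → V →L[𝕜] V'}
  (hT : ∀ (f : WL2 𝕜 wS V) (b : XE), WL2.equiv 𝕜 wE V' (T f) b = ∑ x, t b x (WL2.equiv 𝕜 wS V f x))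

include hPS hPE hT in
/-- **THE SANDWICHED MAP POINTWISE**: `(P^E_{y₁} T P^S_{y₀} f)(b) = 1_{π_E b = y₁}·Σ_{π_S x = y₀} t b x (f x)`. [folklore]
[cite: Balaban1985BackgroundPropagators, (3.49) p.399 «x ∈ Δ(y), supp f ⊂ Δ(y′)»] -/
theorem equiv_block_comp_comp_block [DecidableEq XS] (y₀ y₁ : Y) (f : WL2 𝕜 wS V) (b : XE) :
    WL2.equiv 𝕜 wE V' ((PE y₁ ∘L T ∘L PS y₀) f) b =
      if πE b = y₁ then ∑ x ∈ Finset.univ.filter (fun x => πS x = y₀), t b x (WL2.equiv 𝕜 wS V f x) else 0 := by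
  rw [ContinuousLinearMap.comp_apply, ContinuousLinearMap.comp_apply, hPE, hT]
  by_cases hb : πE b = y₁
  · rw [if_pos hb, if_pos hb, Finset.sum_filter]
    refine Finset.sum_congr rfl fun x _ => ?_
    rw [hPS]
    by_cases hx : πS x = y₀
    · rw [if_pos hx, if_pos hx]
    · rw [if_neg hx, if_neg hx, map_zero]
  · rw [if_neg hb, if_neg hb]

/-- Cauchy–Schwarz against a positive weight: `(Σ_{x∈s} n(x))² ≤ (Σ_{x∈s} w(x)⁻¹)·(Σ_{x∈s} w(x)·n(x)²)` (private helper). [folklore] -/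
private theorem sq_sum_le_sum_inv_mul_sum {ι : Type*} (s : Finset ι) (w n : ι → ℝ) (hw : ∀ i ∈ s, 0 < w i) :
    (∑ i ∈ s, n i) ^ 2 ≤ (∑ i ∈ s, (w i)⁻¹) * ∑ i ∈ s, w i * n i ^ 2 := by
  have hcs := Finset.sum_mul_sq_le_sq_mul_sq s (fun i => (Real.sqrt (w i))⁻¹) (fun i => Real.sqrt (w i) * n i)
  have heq : ∀ i ∈ s, (Real.sqrt (w i))⁻¹ * (Real.sqrt (w i) * n i) = n i := by
    intro i hi
    have h : Real.sqrt (w i) ≠ 0 := (Real.sqrt_pos.mpr (hw i hi)).ne'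
    rw [← mul_assoc, inv_mul_cancel₀ h, one_mul]
  rw [Finset.sum_congr rfl heq] at hcs
  refine hcs.trans (le_of_eq ?_)
  congr 1
  · exact Finset.sum_congr rfl fun i hi => by rw [inv_pow, Real.sq_sqrt (hw i hi).le]
  · exact Finset.sum_congr rfl fun i hi => by rw [mul_pow, Real.sq_sqrt (hw i hi).le]

include hPS hPE hT in
/-- **BLOCKS FROM ENTRIES, pointwise form**: entries `‖t b x‖ ≤ K` on the cell pair, cells of size `≤ N_E`, `≤ N_S`, weights `w_E(b) ≤ ρ·w_S(x)` there ⟹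
`‖P^E_{y₁}(T(P^S_{y₀} f))‖ ≤ √(ρ·N_E·N_S)·K·‖f‖` (Cauchy–Schwarz on the source cell, then the weighted sum over the target cell). [folklore]
[cite: Balaban1985BackgroundPropagators, (3.49) p.399; Balaban1984PropagatorsI, (1.126) p.38] -/
theorem norm_block_comp_comp_block_apply_le [DecidableEq XS] (y₀ y₁ : Y) {K ρ : ℝ} {NS NE : ℕ} (hK0 : 0 ≤ K) (hρ0 : 0 ≤ ρ)
    (hK : ∀ (b : XE) (x : XS), πE b = y₁ → πS x = y₀ → ‖t b x‖ ≤ K)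
    (hρ : ∀ (b : XE) (x : XS), πE b = y₁ → πS x = y₀ → wE b ≤ ρ * wS x)
    (hNS : (Finset.univ.filter (fun x => πS x = y₀)).card ≤ NS) (hNE : (Finset.univ.filter (fun b => πE b = y₁)).card ≤ NE)
    (f : WL2 𝕜 wS V) :
    ‖(PE y₁ ∘L T ∘L PS y₀) f‖ ≤ Real.sqrt (ρ * NE * NS) * K * ‖f‖ := by
  have hwS : ∀ x, 0 < wS x := Fact.out
  have hwE : ∀ b, 0 < wE b := Fact.out
  -- the source cell's weighted mass `F ≤ ‖f‖²`
  have hF0 : 0 ≤ ∑ x ∈ Finset.univ.filter (fun x => πS x = y₀), wS x * ‖WL2.equiv 𝕜 wS V f x‖ ^ 2 :=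
    Finset.sum_nonneg fun x _ => mul_nonneg (hwS x).le (sq_nonneg _)
  have hFle : ∑ x ∈ Finset.univ.filter (fun x => πS x = y₀), wS x * ‖WL2.equiv 𝕜 wS V f x‖ ^ 2 ≤ ‖f‖ ^ 2 := by
    rw [WL2.norm_sq]
    exact Finset.sum_le_sum_of_subset_of_nonneg (Finset.filter_subset _ _) fun x _ _ => mul_nonneg (hwS x).le (sq_nonneg _)
  -- pointwise on the target cell: `w_E(b)‖g(b)‖² ≤ ρ K² N_S F`
  have hpt : ∀ b : XE, πE b = y₁ →
      wE b * ‖WL2.equiv 𝕜 wE V' ((PE y₁ ∘L T ∘L PS y₀) f) b‖ ^ 2 ≤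
        ρ * K ^ 2 * NS * ∑ x ∈ Finset.univ.filter (fun x => πS x = y₀), wS x * ‖WL2.equiv 𝕜 wS V f x‖ ^ 2 := by
    intro b hb
    rw [equiv_block_comp_comp_block hPS hPE hT, if_pos hb]
    -- `‖Σ_x t b x (f x)‖ ≤ K Σ_x ‖f x‖`
    have h1 : ‖∑ x ∈ Finset.univ.filter (fun x => πS x = y₀), t b x (WL2.equiv 𝕜 wS V f x)‖ ≤
        K * ∑ x ∈ Finset.univ.filter (fun x => πS x = y₀), ‖WL2.equiv 𝕜 wS V f x‖ := by
      rw [Finset.mul_sum]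
      refine (norm_sum_le _ _).trans (Finset.sum_le_sum fun x hx => ?_)
      exact (ContinuousLinearMap.le_opNorm _ _).trans (mul_le_mul_of_nonneg_right (hK b x hb (Finset.mem_filter.mp hx).2) (norm_nonneg _))
    -- Cauchy–Schwarz with the weights, and `w_E(b)·Σ_x w_S(x)⁻¹ ≤ ρ N_S`
    have h2 := sq_sum_le_sum_inv_mul_sum (Finset.univ.filter (fun x => πS x = y₀)) wS (fun x => ‖WL2.equiv 𝕜 wS V f x‖) fun x _ => hwS x
    have h3 : wE b * ∑ x ∈ Finset.univ.filter (fun x => πS x = y₀), (wS x)⁻¹ ≤ ρ * NS := by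
      rw [Finset.mul_sum]
      have hterm : ∀ x ∈ Finset.univ.filter (fun x => πS x = y₀), wE b * (wS x)⁻¹ ≤ ρ := by
        intro x hx
        rw [← div_eq_mul_inv, div_le_iff₀ (hwS x)]
        exact hρ b x hb (Finset.mem_filter.mp hx).2
      calc ∑ x ∈ Finset.univ.filter (fun x => πS x = y₀), wE b * (wS x)⁻¹
          ≤ ∑ _x ∈ Finset.univ.filter (fun x => πS x = y₀), ρ := Finset.sum_le_sum hterm
        _ = (Finset.univ.filter (fun x => πS x = y₀)).card * ρ := by rw [Finset.sum_const, nsmul_eq_mul]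
        _ ≤ NS * ρ := mul_le_mul_of_nonneg_right (by exact_mod_cast hNS) hρ0
        _ = ρ * NS := mul_comm _ _
    have hK2 : 0 ≤ K ^ 2 := sq_nonneg _
    calc wE b * ‖∑ x ∈ Finset.univ.filter (fun x => πS x = y₀), t b x (WL2.equiv 𝕜 wS V f x)‖ ^ 2
        ≤ wE b * (K * ∑ x ∈ Finset.univ.filter (fun x => πS x = y₀), ‖WL2.equiv 𝕜 wS V f x‖) ^ 2 :=
          mul_le_mul_of_nonneg_left (pow_le_pow_left₀ (norm_nonneg _) h1 2) (hwE b).le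
      _ = K ^ 2 * (wE b * (∑ x ∈ Finset.univ.filter (fun x => πS x = y₀), ‖WL2.equiv 𝕜 wS V f x‖) ^ 2) := by ring
      _ ≤ K ^ 2 * (wE b * ((∑ x ∈ Finset.univ.filter (fun x => πS x = y₀), (wS x)⁻¹) *
            ∑ x ∈ Finset.univ.filter (fun x => πS x = y₀), wS x * ‖WL2.equiv 𝕜 wS V f x‖ ^ 2)) :=
          mul_le_mul_of_nonneg_left (mul_le_mul_of_nonneg_left h2 (hwE b).le) hK2
      _ = K ^ 2 * ((wE b * ∑ x ∈ Finset.univ.filter (fun x => πS x = y₀), (wS x)⁻¹) *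
            ∑ x ∈ Finset.univ.filter (fun x => πS x = y₀), wS x * ‖WL2.equiv 𝕜 wS V f x‖ ^ 2) := by ring
      _ ≤ K ^ 2 * ((ρ * NS) * ∑ x ∈ Finset.univ.filter (fun x => πS x = y₀), wS x * ‖WL2.equiv 𝕜 wS V f x‖ ^ 2) :=
          mul_le_mul_of_nonneg_left (mul_le_mul_of_nonneg_right h3 hF0) hK2
      _ = ρ * K ^ 2 * NS * ∑ x ∈ Finset.univ.filter (fun x => πS x = y₀), wS x * ‖WL2.equiv 𝕜 wS V f x‖ ^ 2 := by ring
  -- sum over the target cell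
  have hsq : ‖(PE y₁ ∘L T ∘L PS y₀) f‖ ^ 2 ≤ (ρ * NE * NS) * K ^ 2 * ‖f‖ ^ 2 := by
    rw [WL2.norm_sq]
    have hsplit : ∑ b, wE b * ‖WL2.equiv 𝕜 wE V' ((PE y₁ ∘L T ∘L PS y₀) f) b‖ ^ 2 =
        ∑ b ∈ Finset.univ.filter (fun b => πE b = y₁), wE b * ‖WL2.equiv 𝕜 wE V' ((PE y₁ ∘L T ∘L PS y₀) f) b‖ ^ 2 := by
      rw [Finset.sum_filter]
      refine Finset.sum_congr rfl fun b _ => ?_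
      by_cases hb : πE b = y₁
      · rw [if_pos hb]
      · rw [if_neg hb, equiv_block_comp_comp_block hPS hPE hT, if_neg hb, norm_zero]
        simp
    rw [hsplit]
    have hK2 : 0 ≤ K ^ 2 := sq_nonneg _
    calc ∑ b ∈ Finset.univ.filter (fun b => πE b = y₁), wE b * ‖WL2.equiv 𝕜 wE V' ((PE y₁ ∘L T ∘L PS y₀) f) b‖ ^ 2
        ≤ ∑ _b ∈ Finset.univ.filter (fun b => πE b = y₁),
            ρ * K ^ 2 * NS * ∑ x ∈ Finset.univ.filter (fun x => πS x = y₀), wS x * ‖WL2.equiv 𝕜 wS V f x‖ ^ 2 :=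
          Finset.sum_le_sum fun b hb => hpt b (Finset.mem_filter.mp hb).2
      _ = (Finset.univ.filter (fun b => πE b = y₁)).card *
            (ρ * K ^ 2 * NS * ∑ x ∈ Finset.univ.filter (fun x => πS x = y₀), wS x * ‖WL2.equiv 𝕜 wS V f x‖ ^ 2) := by
          rw [Finset.sum_const, nsmul_eq_mul]
      _ ≤ NE * (ρ * K ^ 2 * NS * ‖f‖ ^ 2) := by
          refine mul_le_mul (by exact_mod_cast hNE) (mul_le_mul_of_nonneg_left hFle (by positivity)) (by positivity) (Nat.cast_nonneg _)
      _ = (ρ * NE * NS) * K ^ 2 * ‖f‖ ^ 2 := by ring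
  have hrhs : 0 ≤ Real.sqrt (ρ * NE * NS) * K * ‖f‖ := by positivity
  refine (pow_le_pow_iff_left₀ (norm_nonneg _) hrhs (by norm_num : (2 : ℕ) ≠ 0)).mp ?_
  calc ‖(PE y₁ ∘L T ∘L PS y₀) f‖ ^ 2 ≤ (ρ * NE * NS) * K ^ 2 * ‖f‖ ^ 2 := hsq
    _ = (Real.sqrt (ρ * NE * NS) * K * ‖f‖) ^ 2 := by
        rw [mul_pow, mul_pow, Real.sq_sqrt (by positivity)]

include hPS hPE hT in
/-- **BLOCKS FROM ENTRIES**: `‖P^E_{y₁} ∘ T ∘ P^S_{y₀}‖ ≤ √(ρ·N_E·N_S)·K`. [folklore] [cite: Balaban1985BackgroundPropagators, (3.49) p.399, (3.101) p.414] -/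
theorem opNorm_block_comp_comp_block_le [DecidableEq XS] (y₀ y₁ : Y) {K ρ : ℝ} {NS NE : ℕ} (hK0 : 0 ≤ K) (hρ0 : 0 ≤ ρ)
    (hK : ∀ (b : XE) (x : XS), πE b = y₁ → πS x = y₀ → ‖t b x‖ ≤ K)
    (hρ : ∀ (b : XE) (x : XS), πE b = y₁ → πS x = y₀ → wE b ≤ ρ * wS x)
    (hNS : (Finset.univ.filter (fun x => πS x = y₀)).card ≤ NS) (hNE : (Finset.univ.filter (fun b => πE b = y₁)).card ≤ NE) :
    ‖PE y₁ ∘L T ∘L PS y₀‖ ≤ Real.sqrt (ρ * NE * NS) * K :=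
  ContinuousLinearMap.opNorm_le_bound _ (by positivity)
    (norm_block_comp_comp_block_apply_le hPS hPE hT y₀ y₁ hK0 hρ0 hK hρ hNS hNE)

end Blocks

/-! ## §3 The lattice letter: row L9's `hτ` from a kernel decaying in the coarse torus metric -/

section Lattice

variable {d : ℕ} {L : ℕ} [NeZero L] {m : Fin d → ℕ} {c₀ : ℝ} [Fact (0 < c₀)]
  {W : Type*} [NormedAddCommGroup W] [InnerProductSpace ℂ W]

/-- the bonds based in a block: `#{b : blk(b₋) = y} = d·L^d` (at most). [folklore] [cite: Balaban1985Averaging, (2) p.17] -/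
theorem card_bonds_block_le (y : TSite d m) :
    (Finset.univ.filter (fun b : Bond d (fineP L m) => blockCoord L m (bpos b) = y)).card ≤ d * L ^ d := by
  classical
  have h : Finset.univ.filter (fun b : Bond d (fineP L m) => blockCoord L m (bpos b) = y) =
      (B9Eq319QprimeTorus.blockOf L m y) ×ˢ (Finset.univ : Finset (Fin d)) := by
    ext b
    simp only [Finset.mem_filter, Finset.mem_univ, true_and, Finset.mem_product, and_true, mem_blockOf_iff]
  rw [h, Finset.card_product, card_blockOf, Finset.card_univ, Fintype.card_fin, mul_comm]

/-- the sites of a block: `#Δ(y) = L^d` (at most). [folklore] [cite: Balaban1985Averaging, (2) p.17] -/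
theorem card_sites_block_le (y : TSite d m) :
    (Finset.univ.filter (fun x : TSite d (fineP L m) => blockCoord L m x = y)).card ≤ L ^ d :=
  le_of_eq (card_blockOf L m y : (B9Eq319QprimeTorus.blockOf L m y).card = L ^ d)

/-- **ROW L9's `hτ` FROM A KERNEL** — `(Tf)(b) = Σ_x t b x (f x)` with `‖t b x‖ ≤ K·e^{−κ·d_m(blk(b₋), blk x)}` (`0 ≤ K`) ⟹ for every pair of block
families `P^S`, `P^B` ((K1)'s letters on fine sites ∕ on bonds based in the block) and every `y₀, y₁`:
`‖P^B_{y₁} ∘L T ∘L P^S_{y₀}‖ ≤ (√d·L^d·K)·e^{−(κ·d_m(y₀,y₁))}` — LITERALLY the hypothesis `hτ` of ne9-leaf-01's `B9Eq349KWAssembly.norm_sum_adad_le_lattice`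
with `C_τ := √d·L^d·K`, `r := κ`. [folklore] [cite: Balaban1985BackgroundPropagators, (3.49) p.399, (3.101) p.414] -/
theorem block_decay_of_kernel (hm : ∀ i, 1 ≤ m i)
    (T : SiteL2K ℂ d (fineP L m) c₀ W →L[ℂ] BondL2K ℂ d (fineP L m) c₀ W)
    (t : Bond d (fineP L m) → TSite d (fineP L m) → W →L[ℂ] W)
    (hT : ∀ (f : SiteL2K ℂ d (fineP L m) c₀ W) (b : Bond d (fineP L m)),
      WL2.equiv ℂ (fun _ : Bond d (fineP L m) => c₀) W (T f) b = ∑ x, t b x (WL2.equiv ℂ (fun _ : TSite d (fineP L m) => c₀) W f x))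
    {K κ : ℝ} (hK0 : 0 ≤ K)
    (hK : ∀ (b : Bond d (fineP L m)) (x : TSite d (fineP L m)),
      ‖t b x‖ ≤ K * Real.exp (-(κ * tdist m (blockCoord L m (bpos b)) (blockCoord L m x)))) :
    ∀ (PS : TSite d m → SiteL2K ℂ d (fineP L m) c₀ W →L[ℂ] SiteL2K ℂ d (fineP L m) c₀ W),
      (∀ (y : TSite d m) (f : SiteL2K ℂ d (fineP L m) c₀ W) (x : TSite d (fineP L m)),
        WL2.equiv ℂ (fun _ : TSite d (fineP L m) => c₀) W (PS y f) x =
          if blockCoord L m x = y then WL2.equiv ℂ (fun _ : TSite d (fineP L m) => c₀) W f x else 0) →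
      ∀ (PB : TSite d m → BondL2K ℂ d (fineP L m) c₀ W →L[ℂ] BondL2K ℂ d (fineP L m) c₀ W),
      (∀ (y : TSite d m) (g : BondL2K ℂ d (fineP L m) c₀ W) (b : Bond d (fineP L m)),
        WL2.equiv ℂ (fun _ : Bond d (fineP L m) => c₀) W (PB y g) b =
          if blockCoord L m (bpos b) = y then WL2.equiv ℂ (fun _ : Bond d (fineP L m) => c₀) W g b else 0) →
      ∀ y₀ y₁ : TSite d m, ‖PB y₁ ∘L T ∘L PS y₀‖ ≤ Real.sqrt d * (L : ℝ) ^ d * K * Real.exp (-(κ * tdist m y₀ y₁)) := by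
  classical
  intro PS hPS PB hPB y₀ y₁
  have h := opNorm_block_comp_comp_block_le (πS := blockCoord L m) (πE := fun b : Bond d (fineP L m) => blockCoord L m (bpos b))
    hPS hPB hT y₀ y₁ (K := K * Real.exp (-(κ * tdist m y₀ y₁))) (ρ := 1) (NS := L ^ d) (NE := d * L ^ d)
    (by positivity) zero_le_one
    (fun b x hb hx => by
      have e : tdist m (blockCoord L m (bpos b)) (blockCoord L m x) = tdist m y₀ y₁ := by rw [hb, hx, tdist_symm hm]
      rw [← e]; exact hK b x)
    (fun b x _ _ => by simp) (card_sites_block_le y₀) (card_bonds_block_le y₁)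
  refine h.trans (le_of_eq ?_)
  have hsq : Real.sqrt (1 * ((d * L ^ d : ℕ) : ℝ) * ((L ^ d : ℕ) : ℝ)) = Real.sqrt d * (L : ℝ) ^ d := by
    rw [one_mul, Nat.cast_mul, Nat.cast_pow, show ((d : ℝ) * (L : ℝ) ^ d) * (L : ℝ) ^ d = ((L : ℝ) ^ d) ^ 2 * d by ring,
      Real.sqrt_mul' _ (Nat.cast_nonneg _), Real.sqrt_sq (by positivity), mul_comm]
  rw [hsq]; ring

/-- **… FROM A SCALAR KERNEL** (the flat shape `scalar ⊗ 1_W`): `(Tf)(b) = Σ_x k(b,x)•f(x)`, `‖k(b,x)‖ ≤ K·e^{−κ·d_m(blk(b₋), blk x)}` ⟹ the same `hτ`.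
[folklore] [cite: Balaban1985BackgroundPropagators, (3.49) p.399; Balaban1984PropagatorsI, (1.126) p.38] -/
theorem block_decay_of_scalar_kernel (hm : ∀ i, 1 ≤ m i)
    (T : SiteL2K ℂ d (fineP L m) c₀ W →L[ℂ] BondL2K ℂ d (fineP L m) c₀ W)
    (k : Bond d (fineP L m) → TSite d (fineP L m) → ℂ)
    (hT : ∀ (f : SiteL2K ℂ d (fineP L m) c₀ W) (b : Bond d (fineP L m)),
      WL2.equiv ℂ (fun _ : Bond d (fineP L m) => c₀) W (T f) b = ∑ x, k b x • WL2.equiv ℂ (fun _ : TSite d (fineP L m) => c₀) W f x)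
    {K κ : ℝ} (hK0 : 0 ≤ K)
    (hK : ∀ (b : Bond d (fineP L m)) (x : TSite d (fineP L m)),
      ‖k b x‖ ≤ K * Real.exp (-(κ * tdist m (blockCoord L m (bpos b)) (blockCoord L m x)))) :
    ∀ (PS : TSite d m → SiteL2K ℂ d (fineP L m) c₀ W →L[ℂ] SiteL2K ℂ d (fineP L m) c₀ W),
      (∀ (y : TSite d m) (f : SiteL2K ℂ d (fineP L m) c₀ W) (x : TSite d (fineP L m)),
        WL2.equiv ℂ (fun _ : TSite d (fineP L m) => c₀) W (PS y f) x =
          if blockCoord L m x = y then WL2.equiv ℂ (fun _ : TSite d (fineP L m) => c₀) W f x else 0) →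
      ∀ (PB : TSite d m → BondL2K ℂ d (fineP L m) c₀ W →L[ℂ] BondL2K ℂ d (fineP L m) c₀ W),
      (∀ (y : TSite d m) (g : BondL2K ℂ d (fineP L m) c₀ W) (b : Bond d (fineP L m)),
        WL2.equiv ℂ (fun _ : Bond d (fineP L m) => c₀) W (PB y g) b =
          if blockCoord L m (bpos b) = y then WL2.equiv ℂ (fun _ : Bond d (fineP L m) => c₀) W g b else 0) →
      ∀ y₀ y₁ : TSite d m, ‖PB y₁ ∘L T ∘L PS y₀‖ ≤ Real.sqrt d * (L : ℝ) ^ d * K * Real.exp (-(κ * tdist m y₀ y₁)) :=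
  block_decay_of_kernel hm T (fun b x => k b x • ContinuousLinearMap.id ℂ W)
    (fun f b => by rw [hT]; rfl) hK0
    (fun b x => by
      rw [norm_smul]
      exact (mul_le_of_le_one_right (norm_nonneg _) ContinuousLinearMap.norm_id_le).trans (hK b x))

end Lattice

end Literature.MathematicalPhysics.QuantumFieldTheory.Balaban1983to89.B9Eq349BlockDecayFromKernel

end
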